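import Mathlib.Data.Real.Basic
import Mathlib.Data.Matrix.Basic
import Mathlib.Tactic.Linarith
import Mathlib.Tactic.Ring
import Mathlib.Tactic.Positivity

/-!
# `MatrixDescartes` census — the NULL–DEFINITE PAIRING LEMMA for the Lorentz form on `Sym₂(ℝ)` (W4, boundary strata)

HONEST FRAMING.  Object-search cell `pub-symmetroid`, item `DoorA26 = PosRootLawAt 2 6 19` (stmt-ValiantsHypothesis-19979,
OPEN, typed, never asserted).  Companion of `…CensusGramIsotropic` (the SIGNATURE LEMMA).  On a boundary stratum of a
hypothetical Descartes-sharp `2 × 2` six-term pencil an END letter degenerates to rank one, `Ŝ = ± v vᵀ` (isotropic for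
`det`), and its pairings with the other letters under the polarised determinant form
`B(S,T) = S₀₀T₁₁ + S₁₁T₀₀ − 2 S₀₁T₀₁` are the surviving edge coefficients.  The one fact used by the seat's NULL–DEFINITE
PARITY test (engine-1 g20, note W4-E1G20 §3: on 12 of the 14 core supports of the `−1`-oriented chambers every boundary
stratum is sign-infeasible, so the tropical fan has no live face there) is typed here:

* `polar_pos_of_psdRankOne_posDef_real` — if `(p,q,r) ≠ 0` with `p, r ≥ 0`, `p r = q²` (a non-zero POSITIVE-SEMIDEFINITE
  rank-one letter `v vᵀ`) and `(a,b,c)` is POSITIVE DEFINITE (`a > 0`, `a c − b² > 0`), then `p c + r a − 2 q b > 0`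
  (it equals `vᵀ adj(T) v`); matrix form `polar_pos_of_psdRankOne_posDef`;
* the two polynomial identities behind it (`mul_polar_eq_left/right`), in the pattern of the signature lemma's.

So the SIGN of `B(null, definite)` is forced (`= ε·τ`, `ε` the sign of the null letter, `τ` the type of the definite one), which
together with the definite–definite sign `τ_j τ_k` (reverse Cauchy–Schwarz, the cell's «definite triangle» mechanism) turns
the cell's sign pattern on a boundary edge into a `GF(2)` system.  Nothing here is a certificate about any support, nothing
bounds `ζ_sym(2,6)`, nothing bears on the crux `MatrixDescartes` (stmt-ValiantsHypothesis-18050) or on `VP ≠ VNP`.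
[folklore] Elementary algebra.
-/

-- `Summit.ValiantsHypothesis.ValiantsHypothesis.…` repeats a component by the D-0017 layout
-- (single-conjunct summit), which the `dupNamespace` linter flags; the name is mandated.
set_option linter.dupNamespace false

namespace Summit.ValiantsHypothesis.ValiantsHypothesis.Theorems.LacunarySymmetroidMatrixDescartes.Census

/-- First identity behind the null–definite pairing lemma: with `p r − q² = 0` it reads
`r c · B = (q c − b r)² + r² (a c − b²)`, `B = p c + r a − 2 q b`. [folklore] -/
theorem mul_polar_eq_right (p q r a b c : ℝ) :
    r * c * (p * c + r * a - 2 * q * b) = (q * c - b * r) ^ 2 + r ^ 2 * (a * c - b ^ 2) + c ^ 2 * (p * r - q ^ 2) := by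
  ring

/-- Second identity behind the null–definite pairing lemma: with `p r − q² = 0` it reads
`p a · B = (q a − b p)² + p² (a c − b²)`. [folklore] -/
theorem mul_polar_eq_left (p q r a b c : ℝ) :
    p * a * (p * c + r * a - 2 * q * b) = (q * a - b * p) ^ 2 + p ^ 2 * (a * c - b ^ 2) + a ^ 2 * (p * r - q ^ 2) := by
  ring

/-- **Null–definite pairing lemma, scalar form.**  A non-zero positive-semidefinite rank-one letter `(p,q,r)`
(`p, r ≥ 0`, `p r = q²`) pairs POSITIVELY with every positive-definite letter `(a,b,c)` (`a > 0`, `a c > b²`) under the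
polarised determinant form: `p c + r a − 2 q b > 0` (the value `vᵀ adj(T) v` for `S = v vᵀ`). [folklore] -/
theorem polar_pos_of_psdRankOne_posDef_real (p q r a b c : ℝ) (hp : 0 ≤ p) (hr : 0 ≤ r) (hiso : p * r - q ^ 2 = 0)
    (hne : ¬ (p = 0 ∧ q = 0 ∧ r = 0)) (ha : 0 < a) (hdet : 0 < a * c - b ^ 2) :
    0 < p * c + r * a - 2 * q * b := by
  have hc : 0 < c := by nlinarith [sq_nonneg b]
  rcases lt_or_eq_of_le hp with hp' | hp'
  · -- `p > 0`: use the left identity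
    have h := mul_polar_eq_left p q r a b c
    rw [hiso, mul_zero, add_zero] at h
    have hpos : 0 < (q * a - b * p) ^ 2 + p ^ 2 * (a * c - b ^ 2) := by positivity
    have hpa : 0 < p * a := mul_pos hp' ha
    by_contra hB
    rw [not_lt] at hB
    have : p * a * (p * c + r * a - 2 * q * b) ≤ 0 := mul_nonpos_of_nonneg_of_nonpos hpa.le hB
    linarith
  · -- `p = 0`: then `q = 0`, `r > 0`, use the right identity
    have hp0 : p = 0 := hp'.symm
    have hq0 : q = 0 := by
      have : q ^ 2 = 0 := by rw [hp0] at hiso; linarith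
      exact pow_eq_zero_iff (n := 2) (by norm_num) |>.mp this
    have hr' : 0 < r := by
      rcases lt_or_eq_of_le hr with h | h
      · exact h
      · exact absurd ⟨hp0, hq0, h.symm⟩ hne
    have h := mul_polar_eq_right p q r a b c
    rw [hiso, mul_zero, add_zero] at h
    have hpos : 0 < (q * c - b * r) ^ 2 + r ^ 2 * (a * c - b ^ 2) := by positivity
    have hrc : 0 < r * c := mul_pos hr' hc
    by_contra hB
    rw [not_lt] at hB
    have : r * c * (p * c + r * a - 2 * q * b) ≤ 0 := mul_nonpos_of_nonneg_of_nonpos hrc.le hB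
    linarith

/-- **Null–definite pairing lemma, matrix form** (entries `00, 01, 11`; the letters are meant symmetric).  If `S` is a
non-zero positive-semidefinite rank-one letter (`S₀₀, S₁₁ ≥ 0`, `S₀₀S₁₁ = S₀₁²`) and `T` is positive definite
(`T₀₀ > 0`, `T₀₀T₁₁ − T₀₁² > 0`), then `B(S,T) = S₀₀T₁₁ + S₁₁T₀₀ − 2 S₀₁T₀₁ > 0`.  With `S ↦ −S` / `T ↦ −T` the sign of
`B(null, definite)` is `ε·τ` in general — the input of the null–definite parity test on boundary strata. [folklore] -/
theorem polar_pos_of_psdRankOne_posDef (S T : Matrix (Fin 2) (Fin 2) ℝ) (h00 : 0 ≤ S 0 0) (h11 : 0 ≤ S 1 1)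
    (hiso : S 0 0 * S 1 1 - S 0 1 ^ 2 = 0) (hne : ¬ (S 0 0 = 0 ∧ S 0 1 = 0 ∧ S 1 1 = 0))
    (hT : 0 < T 0 0) (hdet : 0 < T 0 0 * T 1 1 - T 0 1 ^ 2) :
    0 < S 0 0 * T 1 1 + S 1 1 * T 0 0 - 2 * (S 0 1 * T 0 1) := by
  have := polar_pos_of_psdRankOne_posDef_real (S 0 0) (S 0 1) (S 1 1) (T 0 0) (T 0 1) (T 1 1) h00 h11 hiso hne hT hdet
  linarith

/-- The opposite-type reading: a non-zero positive-semidefinite rank-one letter pairs NEGATIVELY with a negative-definite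
letter (`T₀₀ < 0`, `det T > 0`). [folklore] -/
theorem polar_neg_of_psdRankOne_negDef (S T : Matrix (Fin 2) (Fin 2) ℝ) (h00 : 0 ≤ S 0 0) (h11 : 0 ≤ S 1 1)
    (hiso : S 0 0 * S 1 1 - S 0 1 ^ 2 = 0) (hne : ¬ (S 0 0 = 0 ∧ S 0 1 = 0 ∧ S 1 1 = 0))
    (hT : T 0 0 < 0) (hdet : 0 < T 0 0 * T 1 1 - T 0 1 ^ 2) :
    S 0 0 * T 1 1 + S 1 1 * T 0 0 - 2 * (S 0 1 * T 0 1) < 0 := by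
  have := polar_pos_of_psdRankOne_posDef_real (S 0 0) (S 0 1) (S 1 1) (-T 0 0) (-T 0 1) (-T 1 1) h00 h11 hiso hne
    (by linarith) (by nlinarith)
  linarith

end Summit.ValiantsHypothesis.ValiantsHypothesis.Theorems.LacunarySymmetroidMatrixDescartes.Census
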